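import Literature.NumberTheory.PAdicHodge.LabelledHodgeTateWeightsBaseChangeLabelwise
import Literature.NumberTheory.PAdicHodge.FontainePstLabelledWeightsSchemata
import Literature.NumberTheory.PAdicHodge.CrystallineBaseChange
import Literature.NumberTheory.PAdicHodge.BdRBaseChangeFiltered
import Literature.NumberTheory.PAdicHodge.BdRCyclotomic
import Literature.NumberTheory.PAdicHodge.DeRhamInduceLocal
import Literature.NumberTheory.GaloisRepresentations.LabelFilDTransport
import Literature.NumberTheory.GaloisRepresentations.LabelGaloisDescent
import Literature.NumberTheory.GaloisRepresentations.ArtinRestriction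
import Mathlib.FieldTheory.Normal.Closure
import Mathlib.FieldTheory.Galois.IsGaloisGroup
import HarnessLib

/-!
# Labelled Hodge–Tate weights under finite base change, label by label (proofs)

Sources: O. Brinon, B. Conrad, *CMI Summer School notes on p-adic Hodge theory* (2009),
Prop. 6.3.8 (`D_{dR}` and its filtration are insensitive to finite base change:
`L ⊗_K D_{dR,K}(V) ≅ D_{dR,L}(V)` in `Fil_L`, by Galois descent); J.-M. Fontaine, *Représentations
p-adiques semi-stables*, Astérisque 223 (1994), Exposé III §1.5 (functoriality of `D_B` with its
filtration); S. Patrikis, *Variations on a theorem of Tate*, Mem. AMS 258 (2019), §2.7.1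
(`HT_{τ''}(V|_{Γ_L}) = HT_{τ''|_K}(V)`); J. Neukirch, *Algebraic Number Theory* (1999), Ch. IV §1
(restriction maps between absolute Galois groups).

We discharge the named fact
`Literature.NumberTheory.PAdicHodge.LabelledHodgeTateWeightsBaseChangeLabelwise`
(`LabelledHodgeTateWeightsBaseChangeLabelwise_holds`): for a continuous embedding `K → L` of
`ℓ`-adic local fields, a framed `ρ : Γ_K → GL_n(ℚ̄_ℓ)` and a label `τ'' : L → ℚ̄_ℓ`, the
`τ''`-labelled Hodge–Tate multiset of `ρ|_{Γ_L}` for Fontaine's `B_dR(L)` equals the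
`τ'' ∘ (K → L)`-labelled multiset of `ρ` for `B_dR(K)` (THE pinned data `fontainePst`), together with
its siblings `LabelledWeightsRestrictSchema` and the uniform-multiset form
`LabelledHodgeTateWeightsBaseChange` (`CrystallineBaseChange`).

## Proof

Dimension by dimension (`finrank_labelFilD_bdR_restrictField`), for
`X = ℚ̄_ℓⁿ ⊗_{ℚ_ℓ} B_dR(K)` with the diagonal `Γ_K`-action `ρX`:

1. *Transport.*  Along the filtered, `res`-equivariant isomorphism `Φ : B_dR(K) ≃ B_dR(L)`
   extending the chosen `ι : K̄ → L̄` (`exists_fracBdR_ringEquiv_filtered`),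
   `Fil^i D_{τ''}(ρ|_{Γ_L}) ⊆ ℚ̄_ℓⁿ ⊗ B_dR(L)` has the dimension of
   `T ∩ (ℚ̄_ℓⁿ ⊗ Fil^i B_dR(K))`, `T` = the `res(Γ_L)`-invariants on which `Φ⁻¹(L)` acts through
   `τ''` (`PeriodRingData.finrank_labelFilD_eq_finrank_inf`).  Here `Φ⁻¹(L) = ι_K(e(L))` for the
   `K`-embedding `e : L → K̄` with `ι ∘ e = (L ⊆ L̄)`, and `res(Γ_L) = Gal(K̄/e(L))`
   (`exists_algHom_range_absGaloisRestrict_iff`).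
2. *Galois descent* (`LabelGaloisDescent.finrank_eq_of_isGaloisGroup`), applied twice inside the
   Galois closure `Lt` of `L/K` in `K̄` (group `Q = Gal(Lt/K)`, `φ : Γ_K → Q`, `Lt` acting on `X`
   through `ι_K : K̄ → B_dR⁺(K)`), to the common space
   `S₁ = {x ∈ ℚ̄_ℓⁿ ⊗ Fil^i | x fixed by Gal(K̄/Lt), Lt acts through an extension τt of τ''}`:
   with `Kt = K` (group `Q`) it has the dimension of `Fil^i D_{τ''∘(K→L)}(ρ)`; with `Kt = L`
   embedded by `e` (group `Gal(Lt/e L)`, `IsGaloisGroup.of_isScalarTower`) and `G = Γ_L` it has the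
   dimension of `T ∩ (ℚ̄_ℓⁿ ⊗ Fil^i)`.
-/

noncomputable section

open Field ValuativeRel WittVector
open scoped TensorProduct
open TensorProduct
open Literature.NumberTheory.GaloisRepresentations
open Literature.NumberTheory.GaloisRepresentations.IsNonarchimedeanLocalField

namespace Literature.NumberTheory.PAdicHodge

/-! ### The image of `Γ_E → Γ_F`, with the embedding made explicit -/

section RangeRestrict

variable (F E : Type*) [Field F] [Field E] [Algebra F E] [Algebra.IsAlgebraic F E]

/-- **The image of the restriction map `Γ_E → Γ_F`, with its embedding.**  For an algebraic
extension `E/F` there is an `F`-embedding `e : E → F̄` such that (i) the chosen `ι : F̄ → Ē`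
(`absClosureEmbedding`) restricts to `E ⊆ Ē` on `e(E)`, i.e. `ι ∘ e = (E → Ē)`, and (ii)
`res(Γ_E) = Gal(F̄/e(E))`.  This is the tree's `exists_mem_range_absGaloisRestrict_iff` (same
proof) with property (i) of the (same) witness `e = ι⁻¹ ∘ (E → Ē)` recorded.  Neukirch, Ch. IV §1
(restriction between absolute Galois groups); Milne, *Fields and Galois Theory*, §7.
[cite: NeukirchANT1999, Ch. IV §1] -/
theorem exists_algHom_range_absGaloisRestrict_iff :
    ∃ e : E →ₐ[F] AlgebraicClosure F,
      (∀ x : E, absClosureEmbedding F E (e x) = algebraMap E (AlgebraicClosure E) x) ∧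
      ∀ g : absoluteGaloisGroup F,
        g ∈ (absGaloisRestrict F E).range ↔ ∀ x : E, g • e x = e x := by
  -- the chosen `ι : F̄ → Ē` as an `F̄`-algebra structure on `Ē` (inside the proof only)
  letI : Algebra (AlgebraicClosure F) (AlgebraicClosure E) := absClosureAlgebra F E
  haveI : IsScalarTower F (AlgebraicClosure F) (AlgebraicClosure E) := absClosure_isScalarTower F E
  haveI : Algebra.IsAlgebraic (AlgebraicClosure F) (AlgebraicClosure E) :=
    Algebra.IsAlgebraic.tower_top (K := F) (AlgebraicClosure F)
  have hbij : Function.Bijective (absClosureEmbedding F E) :=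
    IsAlgClosed.algebraMap_bijective_of_isIntegral (k := AlgebraicClosure F)
      (K := AlgebraicClosure E)
  let ιe : AlgebraicClosure F ≃ₐ[F] AlgebraicClosure E :=
    AlgEquiv.ofBijective (absClosureEmbedding F E) hbij
  have hιe : ∀ y, ιe y = absClosureEmbedding F E y := fun _ => rfl
  let e : E →ₐ[F] AlgebraicClosure F :=
    ιe.symm.toAlgHom.comp (IsScalarTower.toAlgHom F E (AlgebraicClosure E))
  have he : ∀ x : E, absClosureEmbedding F E (e x) = algebraMap E (AlgebraicClosure E) x :=
    fun x => by
      change ιe (ιe.symm (algebraMap E (AlgebraicClosure E) x)) = _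
      exact ιe.apply_symm_apply _
  refine ⟨e, he, fun g => ⟨?_, fun hg => ?_⟩⟩
  · rintro ⟨τ, rfl⟩ x
    apply hbij.1
    change absClosureEmbedding F E (absGaloisRestrict F E τ • e x) = _
    rw [absGaloisRestrict_apply_smul, he, absoluteGaloisGroup.smul_def, AlgEquiv.commutes]
  · -- build `τ ∈ Γ_E` with `res τ = g`
    let r : AlgebraicClosure E ≃+* AlgebraicClosure E :=
      ιe.symm.toRingEquiv.trans
        (((absoluteGaloisGroup.toAlgEquiv F g).toRingEquiv).trans ιe.toRingEquiv)
    have hr : ∀ y, r y = ιe (g • ιe.symm y) := fun _ => rfl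
    have hcomm : ∀ x : E, r (algebraMap E (AlgebraicClosure E) x) =
        algebraMap E (AlgebraicClosure E) x := fun x => by
      rw [hr]
      change ιe (g • e x) = _
      rw [hg x, hιe, he]
    let τ' : AlgebraicClosure E ≃ₐ[E] AlgebraicClosure E := AlgEquiv.ofRingEquiv (f := r) hcomm
    refine ⟨(absoluteGaloisGroup.toAlgEquiv E).symm τ', ?_⟩
    apply FaithfulSMul.eq_of_smul_eq_smul (α := AlgebraicClosure F)
    intro y
    apply hbij.1
    change absClosureEmbedding F E (absGaloisRestrict F E _ • y) = _
    rw [absGaloisRestrict_apply_smul, absoluteGaloisGroup.toAlgEquiv_symm_apply]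
    change r (absClosureEmbedding F E y) = _
    rw [hr, ← hιe, ιe.symm_apply_apply, hιe]

end RangeRestrict

/-! ### Plumbing -/

/-- Extension of a label `τ : L → E` (`E` algebraically closed) to an algebraic extension
`e : L → Lt` of `L` over `K`: a ring homomorphism `τt : Lt → E` with `τt ∘ e = τ`
(`IsAlgClosed.lift`). [folklore] -/
private theorem exists_ringHom_comp_algHom_eq {K L Lt E : Type*} [Field K] [Field L] [Field Lt]
    [Field E] [Algebra K L] [Algebra K Lt] [Algebra.IsAlgebraic K Lt] [IsAlgClosed E]
    (e : L →ₐ[K] Lt) (τ : L →+* E) : ∃ τt : Lt →+* E, ∀ x : L, τt (e x) = τ x := by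
  letI : Algebra L Lt := e.toRingHom.toAlgebra
  letI : Algebra L E := τ.toAlgebra
  haveI : IsScalarTower K L Lt := IsScalarTower.of_algebraMap_eq fun k => (e.commutes k).symm
  haveI : Algebra.IsAlgebraic L Lt := Algebra.IsAlgebraic.tower_top (K := K) L
  exact ⟨(IsAlgClosed.lift : Lt →ₐ[L] E).toRingHom, fun x =>
    (IsAlgClosed.lift : Lt →ₐ[L] E).commutes x⟩

/-- A submodule cut out by invariance under a family of endomorphisms and by eigen-conditions for a
second family (used for the transported `τ''`-component `T`). [folklore] -/
private theorem exists_submodule_forall_eq {E X : Type*} [Field E] [AddCommGroup X] [Module E X]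
    {ι κ : Type*} (f : ι → Module.End E X) (g : κ → Module.End E X) (c : κ → E) :
    ∃ S : Submodule E X, ∀ x, x ∈ S ↔ (∀ i, f i x = x) ∧ ∀ k, g k x = c k • x := by
  refine ⟨{ carrier := {x | (∀ i, f i x = x) ∧ ∀ k, g k x = c k • x}
            add_mem' := ?_, zero_mem' := ?_, smul_mem' := ?_ }, fun x => Iff.rfl⟩
  · rintro x y ⟨hx1, hx2⟩ ⟨hy1, hy2⟩
    exact ⟨fun i => by rw [map_add, hx1, hy1], fun k => by rw [map_add, hx2, hy2, smul_add]⟩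
  · exact ⟨fun i => map_zero _, fun k => by rw [map_zero, smul_zero]⟩
  · rintro a x ⟨hx1, hx2⟩
    exact ⟨fun i => by rw [map_smul, hx1], fun k => by rw [map_smul, hx2, smul_comm]⟩

/-- A submodule of `Fil` cut out by invariance under part of a family of endomorphisms and by
eigen-conditions for a second family (used for the common space `S₁`). [folklore] -/
private theorem exists_submodule_mem_and_forall_eq {E X : Type*} [Field E] [AddCommGroup X]
    [Module E X] {ι κ : Type*} (Fil : Submodule E X) (p : ι → Prop) (f : ι → Module.End E X)
    (g : κ → Module.End E X) (c : κ → E) :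
    ∃ S : Submodule E X, ∀ x, x ∈ S ↔ x ∈ Fil ∧ (∀ i, p i → f i x = x) ∧ ∀ k, g k x = c k • x := by
  refine ⟨{ carrier := {x | x ∈ Fil ∧ (∀ i, p i → f i x = x) ∧ ∀ k, g k x = c k • x}
            add_mem' := ?_, zero_mem' := ?_, smul_mem' := ?_ }, fun x => Iff.rfl⟩
  · rintro x y ⟨hx, hx1, hx2⟩ ⟨hy, hy1, hy2⟩
    exact ⟨add_mem hx hy, fun i hi => by rw [map_add, hx1 i hi, hy1 i hi],
      fun k => by rw [map_add, hx2, hy2, smul_add]⟩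
  · exact ⟨zero_mem _, fun i _ => map_zero _, fun k => by rw [map_zero, smul_zero]⟩
  · rintro a x ⟨hx, hx1, hx2⟩
    exact ⟨Fil.smul_mem a hx, fun i hi => by rw [map_smul, hx1 i hi],
      fun k => by rw [map_smul, hx2, smul_comm]⟩

/-- **The diagonal action is semilinear for multiplication by the right factor**:
`σ ∘ (1 ⊗ (b · )) = (1 ⊗ (σ b · )) ∘ σ` on `M ⊗_P B`. [folklore] -/
private theorem coeffTensorRep_map_mulLeft {Γ : Type*} [Group Γ] [TopologicalSpace Γ]
    {P F : Type*} [Field P] [Field F] [Algebra P F] {E : Type*} [Field E] [Algebra P E]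
    [TopologicalSpace E] {M : Type*} [AddCommGroup M] [Module E M] [Module P M]
    [IsScalarTower P E M] [TopologicalSpace M] (𝔅 : PeriodRingData Γ P F)
    (ρ : ContinuousRep Γ E M) (σ : Γ) (b : 𝔅.B) (x : M ⊗[P] 𝔅.B) :
    𝔅.coeffTensorRep ρ σ
        (AlgebraTensorModule.map (LinearMap.id : M →ₗ[E] M) (LinearMap.mulLeft P b) x) =
      AlgebraTensorModule.map (LinearMap.id : M →ₗ[E] M) (LinearMap.mulLeft P (σ • b))
        (𝔅.coeffTensorRep ρ σ x) := by
  induction x using TensorProduct.induction_on with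
  | zero => simp only [map_zero]
  | tmul m b' =>
    simp only [AlgebraTensorModule.map_tmul, LinearMap.id_coe, id_eq, LinearMap.mulLeft_apply,
      PeriodRingData.coeffTensorRep_apply_tmul, smul_mul']
  | add x y hx hy => simp only [map_add, hx, hy]

/-! ### The dimension count -/

section LocalField

variable {K L : Type} [Field K] [ValuativeRel K] [TopologicalSpace K] [IsNonarchimedeanLocalField K]
  [CharZero K] [Field L] [ValuativeRel L] [TopologicalSpace L] [IsNonarchimedeanLocalField L]
  [CharZero L] [Algebra K L] {ℓ : ℕ} [Fact ℓ.Prime]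

set_option maxHeartbeats 800000 in
/-- **`dim Fil^i D_{τ''}(ρ|_{Γ_L}) = dim Fil^i D_{τ'' ∘ (K → L)}(ρ)`** for Fontaine's `B_dR(L)`,
`B_dR(K)` (Brinon–Conrad 2009, Prop. 6.3.8; Patrikis 2019, §2.7.1), for a continuous embedding
`K → L` of `ℓ`-adic local fields, a framed `ρ : Γ_K → GL_n(ℚ̄_ℓ)`, any ring homomorphism
`τ'' : L → ℚ̄_ℓ` and any `i`.  The period-ring data are variables pinned by equations to
`bdRPeriodRingData` (eliminated by `subst`), so that the statement applies verbatim to THE datum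
`fontainePst` (`fontainePst_𝔅_eq_bdRPeriodRingData`); the `ℚ_ℓ`-structures of `K`, `L` are
arbitrary (they are unique, `LocalField.ringHom_padic_ext`).  Proof: transport along the filtered
`Φ : B_dR(K) ≃ B_dR(L)` and Galois descent of label components in the Galois closure of `L/K`, see
the module docstring.
[cite: BrinonConrad2009, Prop. 6.3.8] [cite: FontaineAsterisque223III, Exp. III §1.5]
[cite: Patrikis2019, §2.7.1] -/
theorem finrank_labelFilD_bdR_restrictField (hcont : Continuous (algebraMap K L))
    (hK : valuation K (ℓ : K) < 1) (hL : valuation L (ℓ : L) < 1)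
    [Fact (¬ IsUnit ((ℓ : ℕ) : integerC K))]
    [IsAdicComplete (Ideal.span {((ℓ : ℕ) : integerC K)}) (integerC K)]
    [Fact (¬ IsUnit ((ℓ : ℕ) : integerC L))]
    [IsAdicComplete (Ideal.span {((ℓ : ℕ) : integerC L)}) (integerC L)]
    [Algebra ℚ_[ℓ] K] [Algebra ℚ_[ℓ] L]
    (𝔅K : PeriodRingData.{0, 0, 0, 0} (absoluteGaloisGroup K) ℚ_[ℓ] K)
    (h𝔅K : 𝔅K = bdRPeriodRingData (F := K) (p := ℓ) hK)
    (𝔅L : PeriodRingData.{0, 0, 0, 0} (absoluteGaloisGroup L) ℚ_[ℓ] L)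
    (h𝔅L : 𝔅L = bdRPeriodRingData (F := L) (p := ℓ) hL)
    (n : ℕ) (ρ : FramedRep (absoluteGaloisGroup K) (PadicAlgCl ℓ) n) (τ : L →+* PadicAlgCl ℓ)
    (i : ℤ) :
    Module.finrank (PadicAlgCl ℓ)
        ↥(𝔅L.labelFilD (FramedRep.toContinuousRep (ρ.comp (absGaloisRestrict K L))) τ i) =
      Module.finrank (PadicAlgCl ℓ)
        ↥(𝔅K.labelFilD (FramedRep.toContinuousRep ρ) (τ.comp (algebraMap K L)) i) := by
  subst h𝔅K h𝔅L
  classical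
  -- ### pinned data
  have hFK := surjective_fontaineTheta_integerC hK
  have hFL := surjective_fontaineTheta_integerC hL
  have halgK : ∀ c : ℚ_[ℓ], algebraMap ℚ_[ℓ] K c = LocalField.padicRingHom K ℓ hK c := fun c =>
    RingHom.congr_fun (LocalField.ringHom_padic_ext _ _) c
  have halgL : ∀ c : ℚ_[ℓ], algebraMap ℚ_[ℓ] L c = LocalField.padicRingHom L ℓ hL c := fun c =>
    RingHom.congr_fun (LocalField.ringHom_padic_ext _ _) c
  haveI : IsDomain (BDeRhamPlus (integerC K) ℓ) := isDomain_bDeRhamPlus hFK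
  haveI : IsDomain (BDeRhamPlus (integerC L) ℓ) := isDomain_bDeRhamPlus hFL
  haveI : Algebra.IsAlgebraic K L := algebra_isAlgebraic_of_continuous_algebraMap hcont hK hL
  haveI : FiniteDimensional K L := finiteDimensional_of_continuous_algebraMap hcont hK hL
  -- ### Step 1: transport along `Φ : B_dR(K) ≃ B_dR(L)`
  obtain ⟨Φ, hΦgal, hΦqp, hΦι, -, hΦfil⟩ :=
    exists_fracBdR_ringEquiv_filtered (ℓ := ℓ) hcont hK hL hFK hFL
  have hΦP : ∀ c : ℚ_[ℓ], Φ (algebraMap ℚ_[ℓ] (bdRPeriodRingData (F := K) (p := ℓ) hK).B c) =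
      algebraMap ℚ_[ℓ] (bdRPeriodRingData (F := L) (p := ℓ) hL).B c := fun c => by
    rw [PeriodRingData.algebraMap_eq, PeriodRingData.algebraMap_eq,
      algebraMap_bdRPeriodRingData hFK hK, algebraMap_bdRPeriodRingData hFL hL,
      embBdRHom_algebraMap_padic hK hFK halgK, embBdRHom_algebraMap_padic hL hFL halgL]
    exact hΦqp c
  have hfil : ∀ (i : ℤ) (b : (bdRPeriodRingData (F := K) (p := ℓ) hK).B),
      b ∈ (bdRPeriodRingData (F := K) (p := ℓ) hK).fil i ↔
        Φ b ∈ (bdRPeriodRingData (F := L) (p := ℓ) hL).fil i := fun i b => hΦfil i b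
  -- an `K`-embedding `e : L → K̄` with `ι ∘ e = (L ⊆ L̄)` and `res(Γ_L) = Gal(K̄ / e L)`
  obtain ⟨e, he, hrange⟩ := exists_algHom_range_absGaloisRestrict_iff K L
  -- the space `X = ℚ̄_ℓⁿ ⊗ B_dR(K)` with its diagonal `Γ_K`-action and `M ⊗ Fil^i`
  set ρX : Representation (PadicAlgCl ℓ) (absoluteGaloisGroup K)
      ((Fin n → PadicAlgCl ℓ) ⊗[ℚ_[ℓ]] (bdRPeriodRingData (F := K) (p := ℓ) hK).B) :=
    (bdRPeriodRingData (F := K) (p := ℓ) hK).coeffTensorRep (FramedRep.toContinuousRep ρ)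
    with hρX_def
  set Fil : Submodule (PadicAlgCl ℓ)
      ((Fin n → PadicAlgCl ℓ) ⊗[ℚ_[ℓ]] (bdRPeriodRingData (F := K) (p := ℓ) hK).B) :=
    (bdRPeriodRingData (F := K) (p := ℓ) hK).coeffFilTensor (PadicAlgCl ℓ) (Fin n → PadicAlgCl ℓ) i
    with hFil_def
  -- the transported `τ`-component `T`
  obtain ⟨T, hT⟩ : ∃ T : Submodule (PadicAlgCl ℓ)
      ((Fin n → PadicAlgCl ℓ) ⊗[ℚ_[ℓ]] (bdRPeriodRingData (F := K) (p := ℓ) hK).B),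
      ∀ y, y ∈ T ↔ (∀ g : absoluteGaloisGroup L, ρX (absGaloisRestrict K L g) y = y) ∧
        ∀ f : L, AlgebraTensorModule.map (LinearMap.id : (Fin n → PadicAlgCl ℓ) →ₗ[PadicAlgCl ℓ]
            (Fin n → PadicAlgCl ℓ)) (LinearMap.mulLeft ℚ_[ℓ]
            (A := (bdRPeriodRingData (F := K) (p := ℓ) hK).B)
            (Φ.symm (algebraMap L (bdRPeriodRingData (F := L) (p := ℓ) hL).B f))) y = τ f • y :=
    exists_submodule_forall_eq (fun g : absoluteGaloisGroup L => ρX (absGaloisRestrict K L g))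
      (fun f : L => AlgebraTensorModule.map (LinearMap.id : (Fin n → PadicAlgCl ℓ) →ₗ[PadicAlgCl ℓ]
        (Fin n → PadicAlgCl ℓ)) (LinearMap.mulLeft ℚ_[ℓ]
        (A := (bdRPeriodRingData (F := K) (p := ℓ) hK).B)
        (Φ.symm (algebraMap L (bdRPeriodRingData (F := L) (p := ℓ) hL).B f)))) τ
  have htr := PeriodRingData.finrank_labelFilD_eq_finrank_inf
    (bdRPeriodRingData (F := K) (p := ℓ) hK) (bdRPeriodRingData (F := L) (p := ℓ) hL)
    (FramedRep.toContinuousRep ρ) (FramedRep.toContinuousRep (ρ.comp (absGaloisRestrict K L)))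
    (absGaloisRestrict K L) (fun _ _ => rfl) Φ hΦP (fun σ b => hΦgal σ b) hfil τ T hT i
  rw [htr]
  -- ### Step 2: the Galois closure `Lt` of `L / K` in `K̄`, `Q = Gal(Lt/K)`, `φ : Γ_K → Q`
  let Lt : IntermediateField K (AlgebraicClosure K) :=
    IntermediateField.normalClosure K L (AlgebraicClosure K)
  haveI : Normal K Lt := normalClosure.normal K L (AlgebraicClosure K)
  haveI : FiniteDimensional K Lt := normalClosure.is_finiteDimensional K L (AlgebraicClosure K)
  haveI : IsGalois K Lt := ⟨⟩
  let φ : absoluteGaloisGroup K →* (Lt ≃ₐ[K] Lt) :=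
    (AlgEquiv.restrictNormalHom Lt).comp (absoluteGaloisGroup.toAlgEquiv K).toMonoidHom
  have hφx : ∀ (σ : absoluteGaloisGroup K) (x : Lt),
      algebraMap Lt (AlgebraicClosure K) (φ σ • x) = σ • algebraMap Lt (AlgebraicClosure K) x :=
    fun σ x => AlgEquiv.restrictNormal_commutes (absoluteGaloisGroup.toAlgEquiv K σ) Lt x
  have hφ : Function.Surjective φ :=
    (AlgEquiv.restrictNormalHom_surjective (F := K) (K₁ := Lt) (AlgebraicClosure K)).comp
      (absoluteGaloisGroup.toAlgEquiv K).surjective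
  -- `e` lands in `Lt`
  let e' : L →ₐ[K] Lt := (normalClosure.algHomEquiv K L (AlgebraicClosure K)).symm e
  have he' : ∀ x : L, algebraMap Lt (AlgebraicClosure K) (e' x) = e x := fun x =>
    DFunLike.congr_fun ((normalClosure.algHomEquiv K L (AlgebraicClosure K)).apply_symm_apply e) x
  -- the label extended to `Lt`
  obtain ⟨τt, hτt⟩ := exists_ringHom_comp_algHom_eq (K := K) (E := PadicAlgCl ℓ) e' τ
  -- `Lt` acts on `X` through `ι_K : K̄ → B_dR⁺(K) ⊆ B_dR(K)`
  let j : Lt →+* (bdRPeriodRingData (F := K) (p := ℓ) hK).B :=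
    (algebraMap (BDeRhamPlus (integerC K) ℓ) (FracBdR K ℓ)).comp
      ((algClosureToBdR hK hFK).comp (algebraMap Lt (AlgebraicClosure K)))
  have hj : ∀ x : Lt, j x = algebraMap (BDeRhamPlus (integerC K) ℓ) (FracBdR K ℓ)
      (algClosureToBdR hK hFK (algebraMap Lt (AlgebraicClosure K) x)) := fun _ => rfl
  obtain ⟨μ, hμ⟩ := (bdRPeriodRingData (F := K) (p := ℓ) hK).exists_ringHom_forall_apply_eq_map_mulLeft
    (E := PadicAlgCl ℓ) (M := Fin n → PadicAlgCl ℓ) j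
  have hjσ : ∀ (σ : absoluteGaloisGroup K) (x : Lt), σ • j x = j (φ σ • x) := fun σ x => by
    rw [hj, hj, hφx, ← galBdRPlus_algClosureToBdR hK hFK]
    -- the `Γ_K`-action of the datum is the one of `FracBdR K ℓ` (definitionally)
    exact smul_algebraMap_fracBdR σ _
  have hj0 : ∀ x : Lt, j x ∈ (bdRPeriodRingData (F := K) (p := ℓ) hK).fil 0 := fun x =>
    algebraMap_mem_fil_zero hK hFK _
  have hρμ : ∀ (σ : absoluteGaloisGroup K) (l : Lt)
      (x : (Fin n → PadicAlgCl ℓ) ⊗[ℚ_[ℓ]] (bdRPeriodRingData (F := K) (p := ℓ) hK).B),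
      ρX σ (μ l x) = μ (φ σ • l) (ρX σ x) := fun σ l x => by
    rw [hμ, hμ, hρX_def, coeffTensorRep_map_mulLeft, hjσ]
  have hFρ : ∀ (σ : absoluteGaloisGroup K)
      (x : (Fin n → PadicAlgCl ℓ) ⊗[ℚ_[ℓ]] (bdRPeriodRingData (F := K) (p := ℓ) hK).B),
      x ∈ Fil → ρX σ x ∈ Fil := fun σ x hx =>
    (bdRPeriodRingData (F := K) (p := ℓ) hK).coeffTensorRep_mem_coeffFilTensor
      (FramedRep.toContinuousRep ρ) σ hx
  have hFμ : ∀ (l : Lt)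
      (x : (Fin n → PadicAlgCl ℓ) ⊗[ℚ_[ℓ]] (bdRPeriodRingData (F := K) (p := ℓ) hK).B),
      x ∈ Fil → μ l x ∈ Fil := fun l x hx => by
    rw [hμ]
    exact (bdRPeriodRingData (F := K) (p := ℓ) hK).map_mulLeft_mem_coeffFilTensor (hj0 l) hx
  -- the common space `S₁`
  obtain ⟨S₁, hS₁⟩ : ∃ S₁ : Submodule (PadicAlgCl ℓ)
      ((Fin n → PadicAlgCl ℓ) ⊗[ℚ_[ℓ]] (bdRPeriodRingData (F := K) (p := ℓ) hK).B),
      ∀ x, x ∈ S₁ ↔ x ∈ Fil ∧ (∀ σ : absoluteGaloisGroup K, φ σ = 1 → ρX σ x = x) ∧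
        ∀ l : Lt, μ l x = τt l • x :=
    exists_submodule_mem_and_forall_eq Fil (fun σ => φ σ = 1) (fun σ => ρX σ) (fun l => μ l)
      (fun l => τt l)
  -- ### Step 3: descent from `Lt` to `K` (group `Q`): `dim S₁ = dim Fil^i D_{τ ∘ (K → L)}(ρ)`
  have hjK : ∀ k : K, j (algebraMap K Lt k) =
      algebraMap K (bdRPeriodRingData (F := K) (p := ℓ) hK).B k := fun k => by
    rw [hj, algebraMap_bdRPeriodRingData hFK hK, ← algClosureToBdR_algebraMap hK hFK k,
      ← IsScalarTower.algebraMap_apply K Lt (AlgebraicClosure K) k]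
  have hτK : ∀ k : K, τt (algebraMap K Lt k) = τ (algebraMap K L k) := fun k => by
    rw [← e'.commutes k, hτt]
  have hS₂ : ∀ x, x ∈ (bdRPeriodRingData (F := K) (p := ℓ) hK).labelFilD
      (FramedRep.toContinuousRep ρ) (τ.comp (algebraMap K L)) i ↔
      x ∈ Fil ∧ (∀ σ : absoluteGaloisGroup K, ρX σ x = x) ∧
        ∀ k : K, μ (algebraMap K Lt k) x = τt (algebraMap K Lt k) • x := by
    intro x
    have hk : ∀ k : K, μ (algebraMap K Lt k) x =
        (bdRPeriodRingData (F := K) (p := ℓ) hK).baseAct (PadicAlgCl ℓ) (Fin n → PadicAlgCl ℓ) k x :=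
      fun k => by rw [hμ, hjK, PeriodRingData.baseAct_eq_map_mulLeft]
    simp only [PeriodRingData.labelFilD, Submodule.mem_inf, PeriodRingData.mem_labelD_iff,
      PeriodRingData.mem_coeffD_iff, RingHom.coe_comp, Function.comp_apply, hk, hτK]
    exact ⟨fun h => ⟨h.2, h.1.1, h.1.2⟩, fun h => ⟨⟨h.2.1, h.2.2⟩, h.1⟩⟩
  have h1 : Module.finrank (PadicAlgCl ℓ) S₁ = Module.finrank (PadicAlgCl ℓ)
      ↥((bdRPeriodRingData (F := K) (p := ℓ) hK).labelFilD (FramedRep.toContinuousRep ρ)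
        (τ.comp (algebraMap K L)) i) :=
    finrank_eq_of_isGaloisGroup (Kt := K) φ hφ ρX μ hρμ τt Fil hFρ hFμ S₁ _ hS₁ hS₂
  -- ### Step 4: descent from `Lt` to `e(L)` (group `Gal(Lt / e L)`, `G = Γ_L`): `dim S₁ = dim (T ⊓ Fil)`
  letI : Algebra L Lt := e'.toRingHom.toAlgebra
  haveI : IsScalarTower K L Lt := IsScalarTower.of_algebraMap_eq fun k => (e'.commutes k).symm
  have halgLt : ∀ x : L, algebraMap L Lt x = e' x := fun _ => rfl
  haveI := IsGaloisGroup.of_isScalarTower (Lt ≃ₐ[K] Lt) K Lt L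
  have hmemQ₂ : ∀ g : absoluteGaloisGroup L,
      (φ.comp (absGaloisRestrict K L).toMonoidHom) g ∈
        fixingSubgroup (Lt ≃ₐ[K] Lt) (Set.range (algebraMap L Lt)) := by
    intro g
    rw [mem_fixingSubgroup_iff]
    rintro _ ⟨x, rfl⟩
    apply (algebraMap Lt (AlgebraicClosure K)).injective
    change algebraMap Lt (AlgebraicClosure K) (φ (absGaloisRestrict K L g) • algebraMap L Lt x) = _
    rw [hφx, halgLt, he']
    exact (hrange _).1 ⟨g, rfl⟩ x
  let φ₂ : absoluteGaloisGroup L →* ↥(fixingSubgroup (Lt ≃ₐ[K] Lt) (Set.range (algebraMap L Lt))) :=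
    (φ.comp (absGaloisRestrict K L).toMonoidHom).codRestrict _ hmemQ₂
  have hφ₂v : ∀ g : absoluteGaloisGroup L, ((φ₂ g : ↥(fixingSubgroup (Lt ≃ₐ[K] Lt)
      (Set.range (algebraMap L Lt)))) : Lt ≃ₐ[K] Lt) = φ (absGaloisRestrict K L g) := fun _ => rfl
  -- elements of `Γ_K` fixing `e(L)` come from `Γ_L`
  have hlift : ∀ σ : absoluteGaloisGroup K, (∀ x : L, φ σ • e' x = e' x) →
      ∃ g : absoluteGaloisGroup L, absGaloisRestrict K L g = σ := by
    intro σ hσ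
    have hσfix : ∀ x : L, σ • e x = e x := fun x => by
      rw [← he', ← hφx, hσ]
    obtain ⟨g, hg⟩ := (hrange σ).2 hσfix
    exact ⟨g, hg⟩
  have hφ₂ : Function.Surjective φ₂ := by
    intro q
    obtain ⟨σ, hσ⟩ := hφ (q : Lt ≃ₐ[K] Lt)
    obtain ⟨g, hg⟩ := hlift σ fun x => by
      rw [hσ]
      exact (mem_fixingSubgroup_iff _).1 q.2 _ ⟨x, rfl⟩
    refine ⟨g, Subtype.ext ?_⟩
    rw [hφ₂v, hg, hσ]
  have hρμ₂ : ∀ (g : absoluteGaloisGroup L) (l : Lt)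
      (x : (Fin n → PadicAlgCl ℓ) ⊗[ℚ_[ℓ]] (bdRPeriodRingData (F := K) (p := ℓ) hK).B),
      (ρX.comp (absGaloisRestrict K L).toMonoidHom) g (μ l x) =
        μ (φ₂ g • l) ((ρX.comp (absGaloisRestrict K L).toMonoidHom) g x) := fun g l x =>
    hρμ (absGaloisRestrict K L g) l x
  have hFρ₂ : ∀ (g : absoluteGaloisGroup L)
      (x : (Fin n → PadicAlgCl ℓ) ⊗[ℚ_[ℓ]] (bdRPeriodRingData (F := K) (p := ℓ) hK).B),
      x ∈ Fil → (ρX.comp (absGaloisRestrict K L).toMonoidHom) g x ∈ Fil := fun g x hx =>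
    hFρ (absGaloisRestrict K L g) x hx
  have hS₁' : ∀ x, x ∈ S₁ ↔ x ∈ Fil ∧
      (∀ g : absoluteGaloisGroup L, φ₂ g = 1 → (ρX.comp (absGaloisRestrict K L).toMonoidHom) g x = x) ∧
        ∀ l : Lt, μ l x = τt l • x := by
    intro x
    rw [hS₁]
    refine and_congr_right fun _ => and_congr_left fun _ => ⟨fun h g hg => ?_, fun h σ hσ => ?_⟩
    · have hφg : φ (absGaloisRestrict K L g) = 1 := by
        simpa only [hφ₂v, OneMemClass.coe_one] using congrArg Subtype.val hg
      exact h (absGaloisRestrict K L g) hφg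
    · obtain ⟨g, hg⟩ := hlift σ fun x => by rw [hσ, one_smul]
      have hφ₂g : φ₂ g = 1 := Subtype.ext (by simpa only [hφ₂v, hg, OneMemClass.coe_one] using hσ)
      have := h g hφ₂g
      rw [← hg]
      exact this
  have hjΦ : ∀ k : L, j (algebraMap L Lt k) =
      Φ.symm (algebraMap L (bdRPeriodRingData (F := L) (p := ℓ) hL).B k) := fun k => by
    apply Φ.injective
    rw [RingEquiv.apply_symm_apply, hj, hΦι, halgLt, he', he, algClosureToBdR_algebraMap,
      algebraMap_bdRPeriodRingData hFL hL]
  have hS₂' : ∀ x, x ∈ T ⊓ Fil ↔ x ∈ Fil ∧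
      (∀ g : absoluteGaloisGroup L, (ρX.comp (absGaloisRestrict K L).toMonoidHom) g x = x) ∧
        ∀ k : L, μ (algebraMap L Lt k) x = τt (algebraMap L Lt k) • x := by
    intro x
    have hk : ∀ k : L, μ (algebraMap L Lt k) x = AlgebraTensorModule.map
        (LinearMap.id : (Fin n → PadicAlgCl ℓ) →ₗ[PadicAlgCl ℓ] (Fin n → PadicAlgCl ℓ))
        (LinearMap.mulLeft ℚ_[ℓ] (A := (bdRPeriodRingData (F := K) (p := ℓ) hK).B)
          (Φ.symm (algebraMap L (bdRPeriodRingData (F := L) (p := ℓ) hL).B k)))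
        x := fun k => by rw [hμ, hjΦ]
    have hk' : ∀ k : L, τt (algebraMap L Lt k) = τ k := fun k => by rw [halgLt, hτt]
    simp only [Submodule.mem_inf, hT, hk, hk', MonoidHom.coe_comp, Function.comp_apply,
      ContinuousMonoidHom.coe_toMonoidHom]
    exact ⟨fun h => ⟨h.2, h.1.1, h.1.2⟩, fun h => ⟨⟨h.2.1, h.2.2⟩, h.1⟩⟩
  have h2 : Module.finrank (PadicAlgCl ℓ) S₁ = Module.finrank (PadicAlgCl ℓ) ↥(T ⊓ Fil) :=
    finrank_eq_of_isGaloisGroup (Kt := L) φ₂ hφ₂ (ρX.comp (absGaloisRestrict K L).toMonoidHom) μ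
      hρμ₂ τt Fil hFρ₂ hFμ S₁ _ hS₁' hS₂'
  rw [← h2, h1]

/-! ### The named facts -/

/-- **`LabelledHodgeTateWeightsBaseChangeLabelwise` holds** (Brinon–Conrad 2009, Prop. 6.3.8;
Patrikis 2019, §2.7.1; Fontaine 1994, Exp. III §1.5): for THE pinned data `fontainePst`,
`HT_{τ''}(ρ|_{Γ_L}) = HT_{τ'' ∘ (K → L)}(ρ)` for every `ℚ_ℓ`-embedding `τ'' : L → ℚ̄_ℓ`.  The
multisets are the jump multisets of `i ↦ dim Fil^i D_{τ}`, and the dimensions agree by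
`finrank_labelFilD_bdR_restrictField` applied through `fontainePst_𝔅_eq_bdRPeriodRingData`.
[cite: BrinonConrad2009, Prop. 6.3.8] [cite: Patrikis2019, §2.7.1]
[cite: FontaineAsterisque223III, Exp. III §1.5 and §3] -/
theorem LabelledHodgeTateWeightsBaseChangeLabelwise_holds :
    LabelledHodgeTateWeightsBaseChangeLabelwise := by
  intro ℓ _ K L _ _ _ _ _ _ _ _ _ _ _ hcont hK hL n ρ τ''
  haveI : Fact (¬ IsUnit ((ℓ : ℕ) : integerC K)) := ⟨not_isUnit_natCast_integerC hK⟩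
  haveI : IsAdicComplete (Ideal.span {((ℓ : ℕ) : integerC K)}) (integerC K) :=
    isAdicComplete_integerC_natCast hK
  haveI : Fact (¬ IsUnit ((ℓ : ℕ) : integerC L)) := ⟨not_isUnit_natCast_integerC hL⟩
  haveI : IsAdicComplete (Ideal.span {((ℓ : ℕ) : integerC L)}) (integerC L) :=
    isAdicComplete_integerC_natCast hL
  letI := (fontainePst K ℓ hK).algebra
  letI := (fontainePst L ℓ hL).algebra
  rw [PeriodRingData.labelledHodgeTateWeights_def, PeriodRingData.labelledHodgeTateWeights_def]
  congr 1
  funext i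
  exact finrank_labelFilD_bdR_restrictField hcont hK hL _ (fontainePst_𝔅_eq_bdRPeriodRingData hK)
    _ (fontainePst_𝔅_eq_bdRPeriodRingData hL) n ρ τ''.toRingHom i

/-- **`LabelledWeightsRestrictSchema` holds** (`FontainePstLabelledWeightsSchemata`): for THE pinned
data, `HT_{τ''}(ρ|_{Γ_L}) = HT_{τ'}(ρ)` whenever `τ''|_K = τ'` — the label-wise statement with the
restricted label named. [cite: BrinonConrad2009, Prop. 6.3.8] [cite: Patrikis2019, §2.7.1] -/
theorem LabelledWeightsRestrictSchema_holds : LabelledWeightsRestrictSchema := by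
  intro ℓ _ K L _ _ _ _ _ _ _ _ _ _ _ hcont hK hL n ρ τ' τ'' hτ
  rw [← hτ]
  exact LabelledHodgeTateWeightsBaseChangeLabelwise_holds ℓ K L hcont hK hL n ρ τ''

/-- **`LabelledHodgeTateWeightsBaseChange` holds** (`CrystallineBaseChange`, the uniform-multiset
form, Brinon–Conrad 2009, Prop. 6.3.8): if every label of `K` has labelled Hodge–Tate multiset `S`
for THE pinned datum, so does every label of `L` after restriction to `Γ_L`.  From the label-wise
fact through `labelledHodgeTateWeights_eq_of_forall_of_labelwise`; the compatibility of the two pinned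
`ℚ_ℓ`-structures with `K → L` is the uniqueness of ring homomorphisms `ℚ_ℓ → L`
(`LocalField.ringHom_padic_ext`). [cite: BrinonConrad2009, Prop. 6.3.8]
[cite: FontaineAsterisque223III, Exp. III §1.5 and §3] -/
theorem LabelledHodgeTateWeightsBaseChange_holds : LabelledHodgeTateWeightsBaseChange := by
  intro ℓ _ K L _ _ _ _ _ _ _ _ _ _ _ hcont hK hL n ρ S hS τ''
  exact labelledHodgeTateWeights_eq_of_forall_of_labelwise
    LabelledHodgeTateWeightsBaseChangeLabelwise_holds hcont hK hL ρ S
    (fun q => RingHom.congr_fun (LocalField.ringHom_padic_ext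
      ((algebraMap K L).comp (fontainePst K ℓ hK).algebra.algebraMap)
      (fontainePst L ℓ hL).algebra.algebraMap) q) hS τ''

end LocalField

end Literature.NumberTheory.PAdicHodge

end
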